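import Literature.AlgebraicGeometry.Morphisms.ZariskiConnectednessProjective
import Literature.AlgebraicGeometry.Morphisms.DevissageHeart
import Literature.AlgebraicGeometry.Morphisms.CechModuleUnit
import Literature.AlgebraicGeometry.Morphisms.SteinFactorizationReduction
import HarnessLib

/-!
# Zariski's connectedness theorem for proper schemes over Noetherian bases (EGA III₁ 4.3.1–4.3.4)

The local connectedness core of The Stacks Project, Tag 03H2 (1) / Tag 03H0 (More on Morphisms,
Theorems 37.53.5 and 37.53.4) for PROPER schemes over Noetherian local rings, and its consequences:

* `finite_algebraMapΓ_of_isProper` — **finiteness of `H⁰`**: for `f : X → Spec A` proper with `A`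
  Noetherian, `Γ(X, 𝒪_X)` is a finite `A`-module (EGA III₁ Thm. 3.2.1 / The Stacks Project, Tag 02O5,
  case `i = 0`, `𝓕 = 𝒪_X`), from the dévissage of `Literature/AlgebraicGeometry/Morphisms/Devissage.lean`
  and its integral step `heart_holds` (`Literature/AlgebraicGeometry/Morphisms/DevissageHeart.lean`), which
  put `𝒪_X` in the class `𝒦` of coherent modules with finite `Ȟ⁰` and `Ȟ¹`;
* `ZariskiProper.preconnectedSpace_closedFibre` — **for `B` Noetherian local and `g : Y → Spec B` proper
  with `B ≅ Γ(Y, 𝒪_Y)`, the closed fibre `Y ×_B κ_B` is preconnected** (Zariski's connectedness theorem;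
  Hartshorne III Cor. 11.3 for proper instead of projective morphisms = EGA III₁ Cor. 4.3.2), by the
  one-parameter induction of `Literature/AlgebraicGeometry/Morphisms/ZariskiConnectednessProjective.lean`
  with the two projective finiteness inputs replaced by the finiteness theorem for proper morphisms: `Ȟ¹`
  of the closure of `D(a)` is finite by `cechH1_finite_holds` (Tag 02O5, `i = 1`), and `Γ(Y_n, 𝒪)` is
  finite over `B` by `finite_algebraMapΓ_of_isProper`;
* `geometricallyConnected_of_isProper_of_isIso_appTop` — **EGA III₁ Cor. 4.3.4 / Tag 03H2 (1) over a
  Noetherian affine base**: `g : Y → Spec B` proper, `B` Noetherian, `B ≅ Γ(Y, 𝒪_Y)` ⇒ `g` is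
  geometrically connected (all fibres geometrically connected), through the reduction
  `SteinFibre.geometricallyConnected_of_localConn` of
  `Literature/AlgebraicGeometry/Morphisms/SteinFactorizationLocalCriterion.lean` with `𝒩 = {Noetherian rings}`
  and `𝒞 = ⊤`;
* `steinFactorization_geometricallyConnected_of_isLocallyNoetherian` — **the named fact
  `Literature.AlgebraicGeometry.Morphisms.steinFactorization_geometricallyConnected` (Tag 03H2 (1) with (5))
  for every proper `f : X → S` with `S` locally Noetherian**: `f' : X → S'` has geometrically connected
  fibres. (What the named fact asserts beyond this — arbitrary `S` — needs Noetherian approximation of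
  proper morphisms, Tags 09ZR/0A0P.)

Everything is proved; the file declares theorems only; no named facts are introduced.

## References

* A. Grothendieck, J. Dieudonné, EGA III₁ (Publ. Math. IHÉS 11, 1961), Thm. 3.2.1, Thm. 4.3.1,
  Cor. 4.3.2, Cor. 4.3.4.
* The Stacks Project, Tag 03H2 (More on Morphisms, Theorem 37.53.5), Tag 03H0 (Theorem 37.53.4) and their
  proofs; Tag 02O5 (Cohomology of Schemes, Proposition 30.19.1).
* R. Hartshorne, *Algebraic Geometry*, GTM 52 (1977), III Cor. 11.3.
* U. Görtz, T. Wedhorn, *Algebraic Geometry II* (2023), Thm. 23.17, Cor. 23.18; *Algebraic Geometry I*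
  (2020), Lemma 12.63.
-/

noncomputable section

open CategoryTheory AlgebraicGeometry Limits TopologicalSpace Opposite
open Literature.AlgebraicGeometry.Modules

universe u

namespace Literature.AlgebraicGeometry.Morphisms

/-! ## Finiteness of `H⁰` for proper morphisms -/

section H0

variable {A : Type u} [CommRing A] [IsNoetherianRing A] {X : Scheme.{u}} (f : X ⟶ Spec (.of A)) [IsProper f]

/-- **Finiteness of `H⁰(X, 𝒪_X)` for `X` proper over a Noetherian ring** (EGA III₁ Thm. 3.2.1; The Stacks
Project, Tag 02O5, `i = 0`, `𝓕 = 𝒪_X`): `Γ(X, 𝒪_X) = Sections f ⊤` is a finite `A`-module. Proof: by the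
dévissage (`devissage`, Görtz–Wedhorn I, Lemma 12.63) with integral step `heart_holds`, `𝒪_X` lies in the
class `𝒦` of coherent modules with finite Čech `Ȟ⁰` and `Ȟ¹` on a finite affine cover, and `Ȟ⁰ = Γ`
(`moduleFinite_cechMH0_iff`). [cite: StacksProject, Tag 02O5 (Cohomology of Schemes, Proposition 30.19.1, case i = 0 and F = O_X)] -/
theorem moduleFinite_sections_top_of_isProper : Module.Finite A (Sections f ⊤) := by
  haveI : IsLocallyNoetherian X := LocallyOfFiniteType.isLocallyNoetherian f
  haveI : CompactSpace X := QuasiCompact.compactSpace_of_compactSpace f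
  obtain ⟨t, ht⟩ := exists_finite_affineOpens_iSup_eq_top (X := X)
  have hK := devissage (f := f) (U := fun V : t => ((V : X.affineOpens) : X.Opens)) (fun V => V.1.2)
    (heart_holds f (fun V => V.1.2) ht) (SheafOfModules.unit _) ⟨IsAffineLocalizing.unit, IsAffineFiniteType.unit⟩
  have h0 := hK.finite_H0
  rw [moduleFinite_cechMH0_iff f _ _ ht] at h0
  exact h0

/-- Equivalently: the structure map `A → Γ(X, 𝒪_X)` (`algebraMapΓ f`) of a proper `A`-scheme over a
Noetherian ring is a finite ring homomorphism. [cite: StacksProject, Tag 02O5 (Cohomology of Schemes, Proposition 30.19.1, case i = 0 and F = O_X)] -/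
theorem finite_algebraMapΓ_of_isProper : (algebraMapΓ f).Finite := by
  have h1 : ((X.presheaf.map (homOfLE (le_top : (⊤ : X.Opens) ≤ ⊤)).op).hom.comp
      (algebraMapΓ f)).Finite :=
    moduleFinite_sections_top_of_isProper f
  have h2 : (X.presheaf.map (homOfLE (le_top : (⊤ : X.Opens) ≤ ⊤)).op).hom.comp (algebraMapΓ f) =
      algebraMapΓ f := by
    have : (homOfLE (le_top : (⊤ : X.Opens) ≤ ⊤)).op = 𝟙 (op ⊤) := Subsingleton.elim _ _
    rw [this, X.presheaf.map_id]
    rfl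
  rwa [h2] at h1

include f in
/-- Hence `Γ(X, 𝒪_X)` is a Noetherian ring for `X` proper over a Noetherian ring. [folklore] -/
theorem isNoetherianRing_Γ_of_isProper : IsNoetherianRing Γ(X, ⊤) := by
  letI : Algebra A Γ(X, ⊤) := (algebraMapΓ f).toAlgebra
  haveI : Module.Finite A Γ(X, ⊤) := finite_algebraMapΓ_of_isProper f
  have hN : IsNoetherian A Γ(X, ⊤) := isNoetherian_of_isNoetherianRing_of_finite A _
  exact isNoetherian_of_tower A hN

end H0

namespace ZariskiProper

open infinitesimalNeighbourhood IsLocalRing ZariskiProj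

/-! ## Auxiliaries for proper `g : Y → Spec B` -/

section Aux

variable {B : Type u} [CommRing B] {Y : Scheme.{u}} (g : Y ⟶ Spec (.of B)) (I : Ideal B)

/-- For `g` proper and `B` Noetherian, `Γ(Y_n, 𝒪)` is a finite `B`-module (`Y_n → Y → Spec B` is proper;
`finite_algebraMapΓ_of_isProper`). [cite: StacksProject, Tag 02O5 (Cohomology of Schemes, Proposition 30.19.1, case i = 0)] -/
theorem finite_algebraMapΓ_level [IsNoetherianRing B] [IsProper g] (n : ℕ) :
    (algebraMapΓ (ι I g n ≫ g)).Finite :=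
  finite_algebraMapΓ_of_isProper (ι I g n ≫ g)

/-- For `g` proper, `Y_M → Spec Γ(Y_M, 𝒪)` is proper: its composite with the affine (separated)
`Spec Γ(Y_M, 𝒪) → Spec B` is the proper `Y_M → Y → Spec B`. [folklore] -/
theorem isProper_toSpecΓ_level [IsProper g] (M : ℕ) :
    IsProper (infinitesimalNeighbourhood I g M).toSpecΓ := by
  have hfac : (infinitesimalNeighbourhood I g M).toSpecΓ ≫
      Spec.map (CommRingCat.ofHom (algebraMapΓ (ι I g M ≫ g))) = ι I g M ≫ g :=
    toSpecΓ_SpecMap_algebraMapΓ _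
  haveI : IsProper ((infinitesimalNeighbourhood I g M).toSpecΓ ≫
      Spec.map (CommRingCat.ofHom (algebraMapΓ (ι I g M ≫ g)))) := by
    rw [hfac]; infer_instance
  exact IsProper.of_comp _ (Spec.map (CommRingCat.ofHom (algebraMapΓ (ι I g M ≫ g))))

omit I in
/-- A proper scheme over an affine scheme has a finite affine open cover with affine pairwise and triple
intersections (it is separated). [folklore] -/
theorem exists_affine_cover [IsProper g] :
    ∃ t : Finset Y.affineOpens, (⨆ V : t, ((V : Y.affineOpens) : Y.Opens)) = ⊤ ∧
      (∀ V W : t, IsAffineOpen (((V : Y.affineOpens) : Y.Opens) ⊓ ((W : Y.affineOpens) : Y.Opens))) ∧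
      (∀ V W W' : t, IsAffineOpen (((V : Y.affineOpens) : Y.Opens) ⊓ ((W : Y.affineOpens) : Y.Opens) ⊓
        ((W' : Y.affineOpens) : Y.Opens))) := by
  haveI : CompactSpace Y := QuasiCompact.compactSpace_of_compactSpace g
  haveI : Y.IsSeparated := by
    constructor
    rw [← terminal.comp_from g]
    infer_instance
  obtain ⟨t, ht⟩ := exists_finite_affineOpens_iSup_eq_top (X := Y)
  exact ⟨t, ht, fun V W => V.1.2.inf W.1.2, fun V W W' => (V.1.2.inf W.1.2).inf W'.1.2⟩

end Aux

/-! ## The induction -/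

/-- **Zariski's connectedness theorem for proper schemes, induction on an ideal of definition.** For
every Noetherian local ring `B`, elements `s_1, …, s_t ∈ 𝔪_B` with `𝔪_B ⊆ √(s_1, …, s_t)`, and every
proper `g : Y → Spec B` with `B ≅ Γ(Y, 𝒪_Y)`, the closed fibre `Y ×_B κ_B` is preconnected. The proof
is that of `ZariskiProj.preconnectedSpace_closedFibre_induction` (one parameter `a = s_0` at a time:
torsion data for `𝓘 = (a)`, Mittag-Leffler, `Γ(Y_M, 𝒪)` local Noetherian, induction for
`Y_M → Spec Γ(Y_M, 𝒪)`), with: the finite affine cover of the separated scheme `Y` and its affine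
intersections (`exists_affine_cover`) in place of the standard cover of `Y ⊆ 𝐏^r_B`; the finiteness of
`Ȟ¹` of the closure `X̄` of `D(a)` — a closed subscheme of `Y`, proper over `B` — from the finiteness
theorem `cechH1_finite_holds` (Tag 02O5) in place of Serre's theorem; the finiteness of `Γ(Y_M, 𝒪)` from
`finite_algebraMapΓ_of_isProper`; and properness of `Y_M → Spec Γ(Y_M, 𝒪)` (`isProper_toSpecΓ_level`) in
place of projectivity. [cite: StacksProject, Tag 03H0 (More on Morphisms, Theorem 37.53.4, proof) and Tag 03H2 (Theorem 37.53.5 (1))] -/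
theorem preconnectedSpace_closedFibre_induction :
    ∀ (t : ℕ) (B : Type u) [CommRing B] [IsLocalRing B] [IsNoetherianRing B] (s : Fin t → B),
      (∀ i, s i ∈ maximalIdeal B) → maximalIdeal B ≤ (Ideal.span (Set.range s)).radical →
      ∀ ⦃Y : Scheme.{u}⦄ (g : Y ⟶ Spec (.of B)) [IsProper g], IsIso g.appTop →
          PreconnectedSpace ↥(pullback g (Spec.map (CommRingCat.ofHom (residue B)))) := by
  intro t
  induction t with
  | zero =>
    intro B _ _ _ s _ hs Y g _ hiso
    refine preconnectedSpace_closedFibre_of_le_nilradical g (hs.trans (le_of_eq ?_))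
    rw [Set.range_eq_empty, Ideal.span_empty]; rfl
  | succ t ih =>
    intro B _ _ _ s hs' hs Y g _ hiso
    haveI : IsLocallyNoetherian Y := LocallyOfFiniteType.isLocallyNoetherian g
    -- the parameter `a` and `I = (a)`
    set a : B := s 0 with ha
    have hI : Ideal.span {a} ≤ maximalIdeal B := (Ideal.span_singleton_le_iff_mem _).mpr (hs' 0)
    -- a finite affine cover of `Y` with affine intersections
    obtain ⟨tU, hcov, hU2, hU3⟩ := exists_affine_cover g
    have hU : ∀ V : tU, IsAffineOpen (((V : Y.affineOpens) : Y.Opens)) := fun V => V.1.2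
    -- torsion data and finiteness of `Ȟ¹` of the closure `X̄` of `D(a)` (proper over `B`)
    obtain ⟨n₀, Ψ, hΨ, hinj⟩ := TorsionCech.exists_torsionData g a
      (fun V : tU => ((V : Y.affineOpens) : Y.Opens)) hU hU2 hU3
    haveI : Module.Finite B (CechH1 ((Y.basicOpen (algebraMapΓ g a)).ι.imageι ≫ g)
        (preimageFamily (Y.basicOpen (algebraMapΓ g a)).ι.imageι
          (fun V : tU => ((V : Y.affineOpens) : Y.Opens)))) :=
      cechH1_finite_holds ((Y.basicOpen (algebraMapΓ g a)).ι.imageι ≫ g)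
        (preimageFamily (Y.basicOpen (algebraMapΓ g a)).ι.imageι
          (fun V : tU => ((V : Y.affineOpens) : Y.Opens)))
        (fun V => (hU V).preimage _)
        (by
          change ⨆ i, (Y.basicOpen (algebraMapΓ g a)).ι.imageι ⁻¹ᵁ
            ((fun V : tU => ((V : Y.affineOpens) : Y.Opens)) i) = ⊤
          rw [← Scheme.Hom.preimage_iSup, hcov, Scheme.Hom.preimage_top])
    -- Mittag-Leffler: `e : Y_{n₀} → Y_{n₀+N}` over `Y`
    obtain ⟨N, hN⟩ := InfinitesimalCech.exists_restrict_eq_of_torsionData (Ideal.span {a}) g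
      (fun V : tU => ((V : Y.affineOpens) : Y.Opens)) hU hcov (Ideal.mem_span_singleton_self a) Ψ hΨ hinj
    obtain ⟨e, he, hML⟩ := hN N le_rfl
    -- the local Noetherian ring `B_M = Γ(Y_M, 𝒪)`, `M = n₀ + N`
    haveI hlocal : IsLocalRing Γ(infinitesimalNeighbourhood (Ideal.span {a}) g (n₀ + N), ⊤) :=
      isLocalRing_Γ_of_ML g (Ideal.span {a}) hI e he hML
    have hfin := finite_algebraMapΓ_level g (Ideal.span {a}) (n₀ + N)
    letI : Algebra B Γ(infinitesimalNeighbourhood (Ideal.span {a}) g (n₀ + N), ⊤) :=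
      (algebraMapΓ (ι (Ideal.span {a}) g (n₀ + N) ≫ g)).toAlgebra
    haveI : Module.Finite B Γ(infinitesimalNeighbourhood (Ideal.span {a}) g (n₀ + N), ⊤) := hfin
    have hNB : IsNoetherian B Γ(infinitesimalNeighbourhood (Ideal.span {a}) g (n₀ + N), ⊤) :=
      isNoetherian_of_isNoetherianRing_of_finite B _
    haveI : IsNoetherianRing Γ(infinitesimalNeighbourhood (Ideal.span {a}) g (n₀ + N), ⊤) :=
      isNoetherian_of_tower B hNB
    haveI hloc : IsLocalHom (algebraMapΓ (ι (Ideal.span {a}) g (n₀ + N) ≫ g)) :=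
      isLocalHom_algebraMapΓ g (Ideal.span {a}) (n₀ + N)
    -- the new ideal of definition `s' = (s_1, …, s_t)` in `B_M`
    have hs'1 : ∀ i : Fin t, (algebraMapΓ (ι (Ideal.span {a}) g (n₀ + N) ≫ g) ∘ (s ∘ Fin.succ)) i ∈
        maximalIdeal Γ(infinitesimalNeighbourhood (Ideal.span {a}) g (n₀ + N), ⊤) :=
      fun i ↦ (IsLocalRing.mem_maximalIdeal _).mpr
        (map_nonunit _ _ ((IsLocalRing.mem_maximalIdeal _).mp (hs' i.succ)))
    have hrad : maximalIdeal B ≤ (Ideal.span (insert a (Set.range (s ∘ Fin.succ)))).radical := by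
      rwa [← range_eq_insert]
    have hs'2 := maximalIdeal_le_radical_span g (Ideal.span {a}) (n₀ + N) (Ideal.mem_span_singleton_self a)
      (s ∘ Fin.succ) hrad
    -- `Y_M → Spec B_M` is proper with `B_M = Γ(Y_M, 𝒪)`; induction
    haveI := isProper_toSpecΓ_level g (Ideal.span {a}) (n₀ + N)
    haveI : IsIso (infinitesimalNeighbourhood (Ideal.span {a}) g (n₀ + N)).toSpecΓ.appTop := by
      rw [Scheme.toSpecΓ_appTop]; infer_instance
    haveI := ih Γ(infinitesimalNeighbourhood (Ideal.span {a}) g (n₀ + N), ⊤)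
      (algebraMapΓ (ι (Ideal.span {a}) g (n₀ + N) ≫ g) ∘ (s ∘ Fin.succ)) hs'1 hs'2
      (infinitesimalNeighbourhood (Ideal.span {a}) g (n₀ + N)).toSpecΓ inferInstance
    exact preconnectedSpace_closedFibre_of_level g (Ideal.span {a}) hI (n₀ + N)

/-- **Zariski's connectedness theorem (connected closed fibre), proper case.** Let `B` be a Noetherian
local ring and `g : Y → Spec B` proper such that `B → Γ(Y, 𝒪_Y)` is an isomorphism. Then the closed
fibre `Y ×_B κ_B` is preconnected (EGA III₁ Cor. 4.3.2; The Stacks Project, Tag 03H0 = Theorem 37.53.4,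
proof: the fibres of `X → S'` are connected; Hartshorne III Cor. 11.3 states the projective case).
[cite: StacksProject, Tag 03H0 (More on Morphisms, Theorem 37.53.4, proof)] -/
theorem preconnectedSpace_closedFibre {B : Type u} [CommRing B] [IsLocalRing B] [IsNoetherianRing B]
    {Y : Scheme.{u}} (g : Y ⟶ Spec (.of B)) [IsProper g] [IsIso g.appTop] :
    PreconnectedSpace ↥(pullback g (Spec.map (CommRingCat.ofHom (residue B)))) := by
  classical
  obtain ⟨S, hS⟩ := (isNoetherianRing_iff_ideal_fg B).mp inferInstance (maximalIdeal B)
  obtain ⟨t, s, hs⟩ : ∃ (t : ℕ) (s : Fin t → B), Set.range s = (S : Set B) :=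
    ⟨S.card, fun i ↦ (S.equivFin.symm i : B), by
      ext x; simp only [Set.mem_range, Finset.mem_coe]
      exact ⟨fun ⟨i, hi⟩ ↦ hi ▸ (S.equivFin.symm i).2, fun hx ↦ ⟨S.equivFin ⟨x, hx⟩, by simp⟩⟩⟩
  have hspan : Ideal.span (Set.range s) = maximalIdeal B := by rw [hs, hS]
  refine preconnectedSpace_closedFibre_induction t B s (fun i ↦ ?_) ?_ g inferInstance
  · rw [← hspan]; exact Ideal.subset_span ⟨i, rfl⟩
  · rw [hspan]; exact Ideal.le_radical

end ZariskiProper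

/-! ## Geometric connectedness over Noetherian bases -/

open IsLocalRing

/-- **EGA III₁ Cor. 4.3.4 / Tag 03H2 (1) over a Noetherian affine base.** Let `B` be a Noetherian ring and
`g : Y → Spec B` proper with `B → Γ(Y, 𝒪_Y)` an isomorphism (`g_* 𝒪_Y = 𝒪`). Then `g` is geometrically
connected: all its fibres are geometrically connected. Proof: the reduction
`SteinFibre.geometricallyConnected_of_localConn` (localisation, finite free local base changes, closed
points, Tag 04KV; `Literature/AlgebraicGeometry/Morphisms/SteinFactorizationLocalCriterion.lean`) for
`𝒩 = {Noetherian rings}` and all proper morphisms, whose local core is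
`ZariskiProper.preconnectedSpace_closedFibre`. [cite: StacksProject, Tag 03H2 (More on Morphisms, Theorem 37.53.5 (1), S Noetherian affine)] -/
theorem geometricallyConnected_of_isProper_of_isIso_appTop {B : Type u} [CommRing B] [IsNoetherianRing B]
    {Y : Scheme.{u}} (g : Y ⟶ Spec (.of B)) [IsProper g] [IsIso g.appTop] : GeometricallyConnected g := by
  refine SteinFibre.geometricallyConnected_of_localConn (𝒩 := fun B _ ↦ IsNoetherianRing B)
    (𝒞 := fun _ _ _ _ ↦ True) ?_ ?_ (fun _ _ _ _ _ _ _ _ ↦ trivial) ?_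
    (inferInstance : IsNoetherianRing B) g trivial
  · intro B _ P _ hB
    haveI : IsNoetherianRing B := hB
    infer_instance
  · intro B _ 𝔭 _ hB
    haveI : IsNoetherianRing B := hB
    infer_instance
  · intro B _ _ hB Y g _ _ hiso
    haveI : IsNoetherianRing B := hB
    haveI := hiso
    exact ZariskiProper.preconnectedSpace_closedFibre g

/-- **`X → Spec Γ(X, 𝒪_X)` is geometrically connected for `X` proper over a Noetherian affine scheme**
(the fibres of the Stein factorisation over an affine base, Tag 03H2 (1)): `X → Spec Γ(X, 𝒪_X)` is proper
(cancellation), `Γ(X, 𝒪_X)` is Noetherian (finite over `Γ(S, 𝒪_S)`, `finite_algebraMapΓ_of_isProper`), and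
`geometricallyConnected_of_isProper_of_isIso_appTop` applies. [cite: StacksProject, Tag 03H2 (More on Morphisms, Theorem 37.53.5 (1), S Noetherian affine)] -/
theorem geometricallyConnected_toSpecΓ_of_isProper {X S : Scheme.{u}} (f : X ⟶ S) [IsProper f] [IsAffine S]
    [IsNoetherianRing Γ(S, ⊤)] : GeometricallyConnected X.toSpecΓ := by
  haveI : IsNoetherianRing Γ(X, ⊤) := isNoetherianRing_Γ_of_isProper (f ≫ S.isoSpec.hom)
  haveI : IsProper X.toSpecΓ := by
    have hf : f = X.toSpecΓ ≫ Spec.map f.appTop ≫ S.isoSpec.inv := by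
      rw [← Scheme.toSpecΓ_naturality_assoc, Scheme.isoSpec, asIso_inv, IsIso.hom_inv_id,
        Category.comp_id]
    have : IsProper (X.toSpecΓ ≫ Spec.map f.appTop ≫ S.isoSpec.inv) := by rwa [← hf]
    exact IsProper.of_comp X.toSpecΓ (Spec.map f.appTop ≫ S.isoSpec.inv)
  haveI : IsIso X.toSpecΓ.appTop := by rw [Scheme.toSpecΓ_appTop]; infer_instance
  exact geometricallyConnected_of_isProper_of_isIso_appTop X.toSpecΓ

/-- **The Stacks Project, Tag 03H2 (1) with (5), for proper morphisms to locally Noetherian schemes**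
(EGA III₁ Thm. 4.3.1 with Cor. 4.3.4): for `f : X → S` proper with `S` locally Noetherian, the morphism
`f' = f.toNormalization : X → S'` to the normalisation `S'` of `S` in `X` (the Stein factorisation
`X → S' → S`, Tag 03H2 (5)) has geometrically connected fibres — the statement of the named fact
`steinFactorization_geometricallyConnected` for such `f`, `S`. Proof: by
`geometricallyConnected_toNormalization_of_forall_affineOpens` (the question is local on `S'`, whose chart
over an affine open `U ⊆ S` is `Spec Γ(f⁻¹U, 𝒪_X)`, Tag 03GY (3)–(4)) it suffices that
`f⁻¹U → Spec Γ(f⁻¹U, 𝒪)` be geometrically connected for `U ⊆ S` affine open, and `f⁻¹U` is proper over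
the Noetherian affine scheme `U` (`geometricallyConnected_toSpecΓ_of_isProper`).
[cite: StacksProject, Tag 03H2 (More on Morphisms, Theorem 37.53.5 (1) and (5), S locally Noetherian)] -/
theorem steinFactorization_geometricallyConnected_of_isLocallyNoetherian {X S : Scheme.{u}} (f : X ⟶ S)
    [IsProper f] [IsLocallyNoetherian S] : GeometricallyConnected f.toNormalization := by
  refine geometricallyConnected_toNormalization_of_forall_affineOpens f fun U ↦ ?_
  haveI : IsAffine (U : S.Opens) := U.2
  haveI : IsNoetherianRing Γ((U : S.Opens).toScheme, ⊤) :=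
    IsLocallyNoetherian.component_noetherian ⟨⊤, isAffineOpen_top _⟩
  exact geometricallyConnected_toSpecΓ_of_isProper (f ∣_ (U : S.Opens))

end Literature.AlgebraicGeometry.Morphisms

end
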